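import Summits.BirchSwinnertonDyer.Rank1Residual.X4.KuriharaLevelLowering
import Literature.NumberTheory.EllipticCurves.AtkinLehnerSymbolSymmetryProofs
import Literature.NumberTheory.EllipticCurves.PAdicLFunctionInterpolationProofs
import HarnessLib

/-!
# The PARITY of Kurihara numbers: under the Fricke symmetry `[u/n]⁺ = σ [v/n]⁺` (`uvN ≡ −1`) the Kurihara sum at a level with `σ·(−1)^{ν(n)} = −1` VANISHES — in even analytic rank only the levels with `ν(n)` EVEN carry information (cell `b2b-bsdres`, seat additive-p4 gen 20, line V39c; class-free instrument scope)

HONEST FRAMING (verbatim, cell `b2b-bsdres`): the goal of the cell is to DELETE the COMBINATION-SHAPED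
residual classes for ALL analytic-rank `≤ 1` curves over `ℚ` — "full BSD formula for every rank `≤ 1`
curve in class `C`" assembled STRICTLY from published theorems — so that the rank-`≤ 1` remainder
becomes exactly the CONSTRUCTION-SHAPED classes, which are TYPED (missing-input Props), NOT attempted;
this is not "finishing BSD". This file: a class-free KERNEL THEOREM about the census instrument
"Kurihara numbers" (pure algebra + the tree's PROVED Atkin–Lehner symmetry of plus symbols); no named
fact, no conjecture, nothing booked; labels unchanged.

## What is proved

§1 (abstract, any commutative ring `R`). Let `μ : ℚ → R` be `1`-periodic with the weight-`2` Hecke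
relation (eigenvalue `2`) at every prime of the square-free `n`, and suppose the FRICKE-TYPE SYMMETRY
at denominator `n`: `μ(a/n) = σ · μ(c a⁻¹/n)` for all units `a` of `ℤ/n`, with a fixed unit `c` and a
fixed `σ ∈ R`. Then the Kurihara sum `Φ_P^{(n)} = ∑_{a∈(ℤ/n)ˣ} μ(a/n) ∏_{q∣n} ψ_q(a)` satisfies
**`Φ_P^{(n)} = σ·(−1)^{ν(n)}·Φ_P^{(n)}`** (`Phi_primeFactors_eq_sign_mul_of_fricke`): substitute the
symmetry, re-index by the involution `a ↦ c a⁻¹`, expand `∏_q ψ_q(c b⁻¹) = ∑_{T'⊆P}(∏_{P∖T'}ψ_q(c))·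
(−1)^{|T'|}∏_{T'}ψ_q(b)`; every term with `T' ⊊ P` vanishes by `Phi_eq_zero_of_ssubset` (part 2 of
V39). Hence `2·Φ_P^{(n)} = 0` whenever `σ·(−1)^{ν(n)} = −1`, and `Φ_P^{(n)} = 0` if `2 ∈ Rˣ`.

§2 (the tree's `kuriharaNumber f p n ψ`, `p` an odd prime). For a cusp form `f` on `Γ₀(N)` which is
an eigenvector of the FRICKE involution, `w_N f = −σ f` (`σ = ±1`), the tree's PROVED Atkin–Lehner
symmetry of the rational plus symbols (`ratPlusSymbol_div_eq_mul_atkinLehner`, MTT 1986 §I.17 with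
`Q = N`: `[u/m]⁺ = σ[v/m]⁺` when `uvN ≡ −1 (mod m)`) gives the §1 symmetry mod `p` at every level `n`
prime to `N` with `c = −N⁻¹`; so if the mod-`p` symbol of `f` is `T_q`-eigen (eigenvalue `a_q(E)`)
at the Kolyvagin primes of `(E,p)` (hypothesis `hH` — the reduction mod `p` of MTT (4.2), true for the
newform of `E` whenever the symbols at Kolyvagin levels are `p`-integral; kept as a binder here), then
**`kuriharaNumber f p n ψ = 0` for every `n ∈ 𝒩_1(E,p)` with `σ·(−1)^{ν(n)} = −1` and every `ψ`**
(`kuriharaNumber_eq_zero_of_fricke_of_sign`). For the newform of an elliptic curve `σ` is the ROOT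
NUMBER `w_E` (`w_N f_E = −w_E f_E`): in EVEN analytic rank every Kurihara number at a level with an ODD
number of primes vanishes mod `p` (in particular ALL single-prime levels), in ODD analytic rank every
level with an EVEN number of primes (including `n = 1`: `L(E,1) = 0`). This is the symbol-side shadow
of the parity structure of self-dual Kolyvagin systems (Mazur–Rubin 2004 / Howard); it is recorded here
as a KERNEL statement in the census's own currency because single-prime Kurihara statistics in rank `0`
(and pair statistics in rank `1`) are VACUOUS — an instrument-scope fact for every Kurihara lane
(E2-AT3, KURX, KUR5, T-N10K, T-a4-LK) and for this seat's own evidence files (gen 20, V39).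

EVIDENCE (kit PARI/GP j130158/j130196 of this seat, not used by the kernel): 11a1@3 — every
`δ̃_q`, `q ∈ 𝒫_1`, `q ≤ 340`, is `≡ 0 (mod 3)` although `L(E,1)/Ω = 1/5` is a `3`-unit (values
`−237/2, −762/5, −153, −2409/5, …`), while the PAIR levels give units (17a1@5: 5 of 9 pairs non-zero
mod `5`; 37b1@5: 7 of 7).

## References

* B. Mazur, J. Tate, J. Teitelbaum, Invent. Math. 84 (1986), §I.4 (4.2), §I.17. [cite: MazurTateTeitelbaum1986Invent, §I.17]
* M. Kurihara, Contrib. Math. Comput. Sci. 7 (2014) 317–356, §1.1. [cite: Kurihara2014, §1.1]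
* B. Mazur, K. Rubin, Mem. AMS 799 (2004), §4.4 (parity of the core vertices). [cite: MazurRubin2004, §4.4]
* C.-H. Kim, Amer. J. Math. 148 (2026), §1.2.2, §1.4.3. [cite: Kim2022StructureSelmer, §1.4.3 (PDF p. 7)]
-/

noncomputable section

open scoped MatrixGroups ModularForm

open CongruenceSubgroup Finset

open Literature.NumberTheory.EllipticCurves Literature.NumberTheory.EllipticCurves.ModularForms

namespace Summit.BirchSwinnertonDyer.Rank1Residual.LevelLowering

variable {R : Type*} [CommRing R]

/-! ### §1 The abstract parity identity -/

section Abstract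

variable (ψ : (ℓ : ℕ) → (ZMod ℓ)ˣ →* Multiplicative R) {μ : ℚ → R}

/-- `W_T(b⁻¹) = (−1)^{|T|} W_T(b)` (each character is additive). [folklore] -/
theorem weight_inv {m : ℕ} {T : Finset ℕ} (hT : ∀ q ∈ T, q ∣ m) (b : (ZMod m)ˣ) :
    weight ψ m T b⁻¹ = (-1) ^ T.card * weight ψ m T b := by
  unfold weight
  rw [Finset.prod_congr rfl fun q hq ↦ (by rw [chi_inv ψ (hT q hq), neg_eq_neg_one_mul] :
      chi ψ m q b⁻¹ = -1 * chi ψ m q b), Finset.prod_mul_distrib, Finset.prod_const]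

/-- **THE PARITY IDENTITY.** `μ` periodic, Hecke (eigenvalue `2`) at the primes of the square-free `n`,
and Fricke-symmetric at denominator `n`: `μ(a/n) = σ·μ(c·a⁻¹/n)` for every unit `a` (fixed unit `c`,
fixed `σ`). Then `Φ_P^{(n)} = σ·(−1)^{ν(n)}·Φ_P^{(n)}` for the Kurihara sum at `n` (`P` = the primes of
`n`). [cite: MazurTateTeitelbaum1986Invent, §I.17] [cite: Kurihara2014, §1.1] -/
theorem Phi_primeFactors_eq_sign_mul_of_fricke (hμ : IsPeriodic μ) {P : ℕ → Prop}
    (hP : ∀ q, P q → q.Prime ∧ HeckeRel μ q 2) (n : ℕ) [NeZero n] (hn : Squarefree n)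
    (hPn : ∀ q ∈ n.primeFactors, P q) {c : (ZMod n)ˣ} {σ : R}
    (hsym : ∀ a : (ZMod n)ˣ, lev μ n (a : ZMod n) = σ * lev μ n ((c * a⁻¹ : (ZMod n)ˣ) : ZMod n)) :
    Phi ψ μ n n.primeFactors = σ * (-1) ^ n.primeFactors.card * Phi ψ μ n n.primeFactors := by
  have hT : ∀ q ∈ n.primeFactors, q ∣ n := fun q hq ↦ Nat.dvd_of_mem_primeFactors hq
  -- the involution `a ↦ c a⁻¹`
  set e : (ZMod n)ˣ ≃ (ZMod n)ˣ := (Equiv.inv (ZMod n)ˣ).trans (Equiv.mulLeft c) with he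
  have he' : ∀ a : (ZMod n)ˣ, e a = c * a⁻¹ := fun a ↦ rfl
  -- Step 1: substitute the symmetry and re-index
  have h1 : Phi ψ μ n n.primeFactors =
      σ * ∑ b : (ZMod n)ˣ, lev μ n (b : ZMod n) * weight ψ n n.primeFactors (c * b⁻¹) := by
    unfold Phi
    rw [Finset.mul_sum]
    have hre : ∑ a : (ZMod n)ˣ, lev μ n (a : ZMod n) * weight ψ n n.primeFactors a =
        ∑ a : (ZMod n)ˣ, σ * (lev μ n ((c * a⁻¹ : (ZMod n)ˣ) : ZMod n) *
          weight ψ n n.primeFactors (c * (c * a⁻¹)⁻¹)) := by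
      refine Finset.sum_congr rfl fun a _ ↦ ?_
      rw [hsym a, mul_inv_rev, inv_inv, mul_comm a c⁻¹, mul_inv_cancel_left, mul_assoc]
    rw [hre]
    exact Fintype.sum_equiv e _ _ fun a ↦ by rw [he']
  -- Step 2: expand the weight at `c * b⁻¹`
  have h2 : ∀ b : (ZMod n)ˣ, weight ψ n n.primeFactors (c * b⁻¹) =
      ∑ T' ∈ n.primeFactors.powerset,
        ((∏ q ∈ n.primeFactors \ T', chi ψ n q c) * (-1) ^ T'.card) * weight ψ n T' b := by
    intro b
    rw [weight_mul ψ hT c b⁻¹]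
    refine Finset.sum_congr rfl fun T' hT' ↦ ?_
    rw [weight_inv ψ (fun q hq ↦ hT q (Finset.mem_powerset.mp hT' hq)) b, mul_assoc]
  -- Step 3: each `T'` contributes `coef · Φ_{T'}`; the proper ones vanish
  have h3 : ∀ T' ∈ n.primeFactors.powerset,
      ∑ b : (ZMod n)ˣ, lev μ n (b : ZMod n) *
        (((∏ q ∈ n.primeFactors \ T', chi ψ n q c) * (-1) ^ T'.card) * weight ψ n T' b) =
      ((∏ q ∈ n.primeFactors \ T', chi ψ n q c) * (-1) ^ T'.card) * Phi ψ μ n T' := by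
    intro T' _
    rw [Phi, Finset.mul_sum]
    exact Finset.sum_congr rfl fun b _ ↦ by ring
  have hzero : ∀ T' ∈ n.primeFactors.powerset.erase n.primeFactors, Phi ψ μ n T' = 0 := by
    intro T' hT'
    obtain ⟨hne, hsub⟩ := Finset.mem_erase.mp hT'
    exact Phi_eq_zero_of_ssubset ψ hμ hP _ n T' hn hPn
      (Finset.ssubset_iff_subset_ne.mpr ⟨Finset.mem_powerset.mp hsub, hne⟩) rfl
  have hinner : ∑ b : (ZMod n)ˣ, lev μ n (b : ZMod n) * weight ψ n n.primeFactors (c * b⁻¹) =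
      (-1) ^ n.primeFactors.card * Phi ψ μ n n.primeFactors := by
    simp_rw [h2, Finset.mul_sum]
    rw [Finset.sum_comm, Finset.sum_congr rfl h3,
      ← Finset.add_sum_erase _ _ (Finset.mem_powerset_self _), Finset.sdiff_self, Finset.prod_empty,
      one_mul, Finset.sum_eq_zero (s := n.primeFactors.powerset.erase n.primeFactors)
        (fun T' hT' ↦ by rw [hzero T' hT', mul_zero]), add_zero]
  rw [hinner, ← mul_assoc] at h1
  exact h1

/-- **Vanishing at the levels of the wrong parity**: under §1's hypotheses, if `σ·(−1)^{ν(n)} = −1`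
then `2·Φ_P^{(n)} = 0`, hence `Φ_P^{(n)} = 0` as soon as `2` is invertible in `R` (e.g. `R = ℤ/p^k`,
`p` odd). [cite: MazurTateTeitelbaum1986Invent, §I.17] -/
theorem Phi_primeFactors_eq_zero_of_fricke_of_sign (hμ : IsPeriodic μ) {P : ℕ → Prop}
    (hP : ∀ q, P q → q.Prime ∧ HeckeRel μ q 2) (n : ℕ) [NeZero n] (hn : Squarefree n)
    (hPn : ∀ q ∈ n.primeFactors, P q) {c : (ZMod n)ˣ} {σ : R}
    (hsym : ∀ a : (ZMod n)ˣ, lev μ n (a : ZMod n) = σ * lev μ n ((c * a⁻¹ : (ZMod n)ˣ) : ZMod n))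
    (hsign : σ * (-1) ^ n.primeFactors.card = -1) (h2 : IsUnit (2 : R)) :
    Phi ψ μ n n.primeFactors = 0 := by
  have h := Phi_primeFactors_eq_sign_mul_of_fricke ψ hμ hP n hn hPn hsym
  rw [hsign, neg_one_mul, eq_neg_iff_add_eq_zero, ← two_mul] at h
  exact (h2.mul_right_eq_zero).mp h

end Abstract

/-! ### §2 The Kurihara numbers of a Fricke eigenform mod an odd prime `p` -/

section Application

open Literature.NumberTheory.EllipticCurves.Kato

variable (W : WeierstrassCurve ℚ) [W.IsGloballyMinimal] (p : ℕ) [Fact p.Prime]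
  {N : ℕ} [NeZero N] (f : CuspForm (Gamma0 N) 2)

/-- **PARITY VANISHING of mod-`p` Kurihara numbers.** Let `p` be an odd prime, `f ∈ S₂(Γ₀(N))` a
FRICKE eigenvector `w_N f = −σ f` (`σ = 1` or `−1`; for the newform of an elliptic curve `σ` is the
root number `w_E`), whose mod-`p` plus symbol `r ↦ [r]⁺_f mod p` satisfies the Hecke relation with
eigenvalue `a_q(E)` at every Kolyvagin prime `q` of `(E, p)` (hypothesis `hH`: the reduction of MTT
§I.4 (4.2); true whenever the symbols at the Kolyvagin levels are `p`-integral), and let the level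
`N` be prime to every Kolyvagin product (`hNn`; automatic for `N = N_E`). Then for every
`n ∈ 𝒩_1(E, p)` with **`σ·(−1)^{ν(n)} = −1`** and EVERY choice of discrete logarithms `ψ`,
`kuriharaNumber f p n ψ = 0`. (Fricke symmetry: the tree's PROVED `ratPlusSymbol_div_eq_mul_atkinLehner`
with `Q = N`, `[u/n]⁺ = σ [v/n]⁺` for `u v N ≡ −1 (mod n)`, i.e. §1 with `c = −N⁻¹`.) In EVEN analytic
rank (`σ = +1`): every ODD `ν(n)`, in particular ALL single-prime levels; in ODD analytic rank: every
EVEN `ν(n)`. Class-free instrument scope for the Kurihara lanes.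
[cite: MazurTateTeitelbaum1986Invent, §I.17 and §I.4 (4.2)] [cite: Kurihara2014, §1.1]
[cite: Kim2022StructureSelmer, §1.2.2 and §1.4.3 (PDF pp. 5, 7)] -/
theorem kuriharaNumber_eq_zero_of_fricke_of_sign (hp2 : p ≠ 2) {σ : ℤ} (hσ : σ = 1 ∨ σ = -1)
    (hε : atkinLehnerInvolution N 2 N f = (-(σ : ℂ)) • f)
    (hH : ∀ q : ℕ, Kato.IsKolyvaginPrime W p 1 q →
      HeckeRel (fun r : ℚ ↦ ((ratPlusSymbol f r : ℚ) : ZMod p)) q (W.frobeniusTrace q : ZMod p))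
    {n : ℕ} [NeZero n] (hn : Kato.IsKolyvaginProduct W p 1 n) (hNn : N.Coprime n)
    (hsign : (σ : ZMod p) * (-1) ^ n.primeFactors.card = -1)
    (ψ : (q : ℕ) → (ZMod q)ˣ →* Multiplicative (ZMod p)) : kuriharaNumber f p n ψ = 0 := by
  set μ : ℚ → ZMod p := fun r ↦ ((ratPlusSymbol f r : ℚ) : ZMod p) with hμdef
  have hμ : IsPeriodic μ := fun r z ↦ by
    simp only [hμdef]
    rw [ratPlusSymbol_add_intCast_holds (f := f) r z]
  have hP : ∀ q, Kato.IsKolyvaginPrime W p 1 q → q.Prime ∧ HeckeRel μ q 2 := fun q hq ↦ by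
    refine ⟨hq.prime, ?_⟩
    have h := hH q hq
    rwa [(Kato.isKolyvaginPrime_one_iff.mp hq).2.2.2] at h
  -- the Fricke symmetry at denominator `n`, with `c = -N⁻¹`
  set cN : (ZMod n)ˣ := ZMod.unitOfCoprime N hNn with hcN
  have hsym : ∀ a : (ZMod n)ˣ, lev μ n (a : ZMod n) =
      (σ : ZMod p) * lev μ n ((-cN⁻¹ * a⁻¹ : (ZMod n)ˣ) : ZMod n) := by
    intro a
    set u : ℤ := ((a : ZMod n).val : ℤ) with hu
    set v : ℤ := ((((-cN⁻¹ * a⁻¹ : (ZMod n)ˣ) : ZMod n).val : ℕ) : ℤ) with hv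
    -- `u v N ≡ -1 (mod n)`
    have hmod : ((u * (N * v) + 1 : ℤ) : ZMod n) = 0 := by
      have h1 : ((u : ℤ) : ZMod n) = (a : ZMod n) := by
        rw [hu, Int.cast_natCast, ZMod.natCast_zmod_val]
      have h2 : ((v : ℤ) : ZMod n) = ((-cN⁻¹ * a⁻¹ : (ZMod n)ˣ) : ZMod n) := by
        rw [hv, Int.cast_natCast, ZMod.natCast_zmod_val]
      have h3 : ((N : ℕ) : ZMod n) = (cN : ZMod n) := by
        rw [hcN, ZMod.coe_unitOfCoprime]
      push_cast
      rw [h1, h2, h3, Units.val_mul, Units.val_neg]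
      have hc : (cN : ZMod n) * ((cN⁻¹ : (ZMod n)ˣ) : ZMod n) = 1 := Units.mul_inv cN
      have ha : (a : ZMod n) * ((a⁻¹ : (ZMod n)ˣ) : ZMod n) = 1 := Units.mul_inv a
      linear_combination (-((a : ZMod n) * ((a⁻¹ : (ZMod n)ˣ) : ZMod n))) * hc - ha
    obtain ⟨a', ha'⟩ := (ZMod.intCast_zmod_eq_zero_iff_dvd _ n).mp hmod
    have huv : a' * (n : ℤ) - u * ((N : ℤ) * v) = 1 := by linarith
    have hsymQ := ratPlusSymbol_div_eq_mul_atkinLehner (dvd_refl N)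
      (by rw [Nat.div_self (NeZero.pos N)]; exact Nat.coprime_one_right N) f hε
      (by rcases hσ with h | h <;> simp [h]) (NeZero.pos n) (dvd_mul_right N n) huv
    -- cast to `ZMod p`
    simp only [lev, hμdef]
    have hu' : (((a : ZMod n).val : ℕ) : ℚ) = (u : ℚ) := by rw [hu]; push_cast; rfl
    have hv' : ((((-cN⁻¹ * a⁻¹ : (ZMod n)ˣ) : ZMod n).val : ℕ) : ℚ) = (v : ℚ) := by
      rw [hv]; push_cast; rfl
    rw [hu', hv', hsymQ]
    rcases hσ with h | h
    · subst h; simp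
    · subst h; simp [Rat.cast_neg]
  have h0 := Phi_primeFactors_eq_zero_of_fricke_of_sign ψ hμ hP n hn.squarefree hn.2 hsym hsign
    (isUnit_iff_ne_zero.mpr (by
      have : ((2 : ℕ) : ZMod p) ≠ 0 := by
        rw [Ne, ZMod.natCast_eq_zero_iff]
        intro h
        exact hp2 ((Nat.prime_dvd_prime_iff_eq (Fact.out : p.Prime) Nat.prime_two).mp h)
      exact_mod_cast this))
  rw [kuriharaNumber_eq_sum_ratCast]
  simp_rw [prod_attach_toAdd_eq_weight]
  exact h0

end Application

end Summit.BirchSwinnertonDyer.Rank1Residual.LevelLowering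

end
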